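import Summits.QuantumFields.BalabanUV.Beta.GAN24.MonotoneCoarsen
import Summits.QuantumFields.BalabanUV.Beta.GaugeSliceLegitimacy

/-!
# Beta / GAN24 / MonotoneCoarsenReadOut — READ-OUT MATRICES: critical covariance columns ⟹ a Loewner-antitone chain of the read-out blocks ⟹ (MONO-K)₂
# from ONE trace datum (the TRANSVERSE field–field block of a tower of constrained Gaussians; degenerate forms and level-dependent gauge slices allowed)
# (gan24-p4 gen 2, part 2 of `GAN24/MonotoneCoarsen`; BINDER-OWNERS row G-an2-4 ∕ (CONV-C), ALTERNATIVE DISCHARGE «rate OR monotonicity»; NOT IN PRINT — our proof attempt)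

HONEST FRAMING (page 1 of everything the β sub-cell writes): discharging `BetaPertH` makes Bałaban's UV stability UNCONDITIONAL — a
real constructive-QFT result; it is NOT the continuum limit and NOT the Clay problem.  HONEST DEPENDENCY (cell reorg 2026-08-19, verbatim):
«continuum YM on T⁴ ⇐ BetaPertH ∧ nine spine estimates (0/9 proved); BetaPertH ⇐ (D1) ∧ (D4) ∧ CAP+tail; G-an2-4 gates asym, D1 and NE2/3/4.»
HONEST LABEL: «not in print; our proof attempt; alternative discharge of the G-an2-4 row (rate OR monotonicity)»; 0 wall binders instantiated.
ABSOLUTE RULE honoured: nothing cited; [folklore] finite-dimensional linear algebra over part 1 (`MonotoneCoarsen.pairing_coarsen_le`) and gen 1's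
`MonotoneLoewner.norm_sub_apply_le_of_steps` BY NAME; no `def`.

WHAT IS PROVED.  `posSemidef_readOut_sub_of_crit`: coarse∕fine PSD forms, constraint spaces with `C K_f ⊆ K_c`, (STAB) `Cᴴ H_c C ≤ H_f`, a reading matrix `S`
on the coarse legs (fine reading `S C` = composition (1.17)), Hermitian covariance matrices whose columns at the read sources are CRITICAL on the gauge-FREE
constraint spaces (KKT columns whose gauge multiplier does no work — an5's `wM_eq_zero` on co-closed test forms) ⟹ `(S C) Γ_f (S C)ᴴ ≤ S Γ_c Sᴴ`.
`readOut_chain_step`: the same along a tower ⟹ `P j := S j Γ j (S j)ᴴ` Loewner-antitone from `k₀`.  `readOut_entry_dev_le_of_stab` (over `ℂ`): + ONE trace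
datum ⟹ every entry of `P j − P j'` (`j, j' ≥ k₀`) has norm `≤ η₀` and `re tr P j` is `MonotoneTailDown` — (MONO-K)₂ for the transverse read-out block, NO
rate, WHATEVER the level-dependent gauge slices.  This is the kernel form of finding (N1) of `HOME/b2b-balaban-gan24-p4/gen2/LOEWNER-DIAG.md`.
NOT BetaPertH, NOT continuum, NOT Clay.
-/

namespace Summit.QuantumFields.BalabanUV.Beta.GAN24.MonotoneCoarsenReadOut

open Matrix
open Summit.QuantumFields.BalabanUV.Beta.GAN24.MonotoneCoarsen (IsCrit conj_pairing pairing_coarsen_le)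

/-! ## §1 One step: critical columns ⟹ Loewner order of the read-out blocks -/

section ReadOut

variable {𝕜 : Type*} [Field 𝕜] [PartialOrder 𝕜] [StarRing 𝕜] [StarOrderedRing 𝕜]
variable {n : Type*} [Fintype n]

omit [PartialOrder 𝕜] [StarOrderedRing 𝕜] in
/-- `⟨u, M x⟩ = ⟨Mᴴ u, x⟩` (the adjoint form of `conj_pairing`). [folklore] -/
theorem dot_mulVec_eq_conj {m : Type*} [Fintype m] (M : Matrix m n 𝕜) (u : m → 𝕜) (x : n → 𝕜) :
    star u ⬝ᵥ (M *ᵥ x) = star (Mᴴ *ᵥ u) ⬝ᵥ x := by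
  rw [conj_pairing, conjTranspose_conjTranspose]

variable {nc nf l : Type*} [Fintype nc] [Fintype nf] [Fintype l]

/-- **READ-OUT LOEWNER STEP (gauge form).**  Coarse∕fine PSD forms `H_c, H_f` (degenerate allowed), constraint spaces `K_c, K_f`, an averaging `C` with
`C K_f ⊆ K_c` and (STAB) `Cᴴ H_c C ≤ H_f`; a READING matrix `S` on the coarse legs (rows = test forms; the fine reading is `S C`, composition (1.17));
covariance matrices `Γ_c, Γ_f` (Hermitian) whose columns at the read sources are CRITICAL on the gauge-FREE spaces: `IsCrit H_c (Sᴴu) K_c (Γ_c Sᴴu)` and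
`IsCrit H_f (CᴴSᴴu) K_f (Γ_f CᴴSᴴu)` for every `u` (for a KKT system: the gauge multiplier does no work on these sources — an5's `wM_eq_zero` for
co-closed test forms).  Then the read-out blocks are Loewner-ordered: `(S C) Γ_f (S C)ᴴ ≤ S Γ_c Sᴴ`. [folklore] -/
theorem posSemidef_readOut_sub_of_crit {Hf : Matrix nf nf 𝕜} {Hc : Matrix nc nc 𝕜} (hHc : Hc.PosSemidef) {C : Matrix nc nf 𝕜}
    (hstab : (Hf - Cᴴ * Hc * C).PosSemidef) {Kf : Submodule 𝕜 (nf → 𝕜)} {Kc : Submodule 𝕜 (nc → 𝕜)} (hK : ∀ v ∈ Kf, C *ᵥ v ∈ Kc)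
    (S : Matrix l nc 𝕜) {Γf : Matrix nf nf 𝕜} {Γc : Matrix nc nc 𝕜} (hΓf : Γfᴴ = Γf) (hΓc : Γcᴴ = Γc)
    (hf : ∀ u : l → 𝕜, IsCrit Hf (Cᴴ *ᵥ (Sᴴ *ᵥ u)) Kf (Γf *ᵥ (Cᴴ *ᵥ (Sᴴ *ᵥ u))))
    (hc : ∀ u : l → 𝕜, IsCrit Hc (Sᴴ *ᵥ u) Kc (Γc *ᵥ (Sᴴ *ᵥ u))) :
    (S * Γc * Sᴴ - (S * C) * Γf * (S * C)ᴴ).PosSemidef := by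
  have h1 : (S * Γc * Sᴴ).IsHermitian := Matrix.isHermitian_mul_mul_conjTranspose S hΓc
  have h2 : ((S * C) * Γf * (S * C)ᴴ).IsHermitian := Matrix.isHermitian_mul_mul_conjTranspose (S * C) hΓf
  refine PosSemidef.of_dotProduct_mulVec_nonneg (h1.sub h2) fun u => ?_
  rw [sub_mulVec, dotProduct_sub, sub_nonneg]
  have h := pairing_coarsen_le hHc hstab hK (hf u) (hc u)
  have eL : star u ⬝ᵥ (((S * C) * Γf * (S * C)ᴴ) *ᵥ u) = star (Cᴴ *ᵥ (Sᴴ *ᵥ u)) ⬝ᵥ (Γf *ᵥ (Cᴴ *ᵥ (Sᴴ *ᵥ u))) := by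
    rw [conjTranspose_mul, ← mulVec_mulVec, ← mulVec_mulVec, ← mulVec_mulVec, ← mulVec_mulVec, dot_mulVec_eq_conj S,
      dot_mulVec_eq_conj C]
  have eR : star u ⬝ᵥ ((S * Γc * Sᴴ) *ᵥ u) = star (Sᴴ *ᵥ u) ⬝ᵥ (Γc *ᵥ (Sᴴ *ᵥ u)) := by
    rw [← mulVec_mulVec, ← mulVec_mulVec, dot_mulVec_eq_conj S]
  rw [eL, eR]
  exact h

end ReadOut

section ReadOutTower

variable {𝕜 : Type*} [Field 𝕜] [PartialOrder 𝕜] [StarRing 𝕜] [StarOrderedRing 𝕜]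
variable {l : Type*} [Fintype l]
variable {ι : ℕ → Type*} [∀ j, Fintype (ι j)]
variable {H : ∀ j, Matrix (ι j) (ι j) 𝕜} {K : ∀ j, Submodule 𝕜 (ι j → 𝕜)} {Cf : ∀ j, Matrix (ι j) (ι (j + 1)) 𝕜}
  {S : ∀ j, Matrix l (ι j) 𝕜} {Γ : ∀ j, Matrix (ι j) (ι j) 𝕜} {k₀ : ℕ}

/-- **THE READ-OUT CHAIN OF A TOWER (gauge form).**  Levels `ι j` (finer as `j` grows), PSD forms `H j`, gauge-FREE constraint spaces `K j`, one-step
averagings `Cf j : ι (j+1) → ι j` with `Cf j (K (j+1)) ⊆ K j`, readings `S (j+1) = S j * Cf j` ((1.17)), Hermitian covariance matrices `Γ j` with columns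
critical on `K j` at the read sources, and (STAB_j) `(Cf j)ᴴ (H j) (Cf j) ≤ H (j+1)` for `j ≥ k₀`.  Then `P j := S j * Γ j * (S j)ᴴ` is Loewner-ANTITONE
from `k₀` on. [folklore] -/
theorem readOut_chain_step (hH : ∀ j, (H j).PosSemidef) (hK : ∀ j, ∀ v ∈ K (j + 1), Cf j *ᵥ v ∈ K j)
    (hcomp : ∀ j, S (j + 1) = S j * Cf j) (hΓ : ∀ j, (Γ j)ᴴ = Γ j)
    (hcrit : ∀ j (u : l → 𝕜), IsCrit (H j) ((S j)ᴴ *ᵥ u) (K j) (Γ j *ᵥ ((S j)ᴴ *ᵥ u)))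
    (hstab : ∀ j, k₀ ≤ j → (H (j + 1) - (Cf j)ᴴ * H j * Cf j).PosSemidef) :
    ∀ j, k₀ ≤ j → (S j * Γ j * (S j)ᴴ - S (j + 1) * Γ (j + 1) * (S (j + 1))ᴴ).PosSemidef := by
  intro j hj
  rw [hcomp j]
  refine posSemidef_readOut_sub_of_crit (hH j) (hstab j hj) (hK j) (S j) (hΓ (j + 1)) (hΓ j) (fun u => ?_) (hcrit j)
  have h := hcrit (j + 1) u
  rwa [hcomp j, conjTranspose_mul, ← mulVec_mulVec] at h

end ReadOutTower

section ReadOutComplex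

open scoped ComplexOrder
open Summit.QuantumFields.BalabanUV.Beta.CapRowsTail (MonotoneTailDown)
open Summit.QuantumFields.BalabanUV.Beta.GAN24.MonotoneLoewner (norm_sub_apply_le_of_steps monotoneTailDown_re_trace)

variable {l : Type*} [Fintype l]
variable {ι : ℕ → Type*} [∀ j, Fintype (ι j)]
variable {H : ∀ j, Matrix (ι j) (ι j) ℂ} {K : ∀ j, Submodule ℂ (ι j → ℂ)} {Cf : ∀ j, Matrix (ι j) (ι (j + 1)) ℂ}
  {S : ∀ j, Matrix l (ι j) ℂ} {Γ : ∀ j, Matrix (ι j) (ι j) ℂ} {k₀ : ℕ}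

/-- **(MONO-K)₂ FOR THE READ-OUT (TRANSVERSE) BLOCK OF A TOWER, FROM (STAB) AND ONE TRACE DATUM — NO RATE, ANY GAUGE SLICES.**  Under the hypotheses
of `readOut_chain_step` over `ℂ` and ONE datum `re tr (P k₀ − P j) ≤ η₀` for `j ≥ k₀` (`P j := S j Γ j (S j)ᴴ`): every entry of `P j − P j'`
(`j, j' ≥ k₀`) has norm `≤ η₀`, and `j ↦ re tr P j` satisfies an5's `MonotoneTailDown` (gen 1's `MonotoneLoewner` BY NAME). [folklore] -/
theorem readOut_entry_dev_le_of_stab (hH : ∀ j, (H j).PosSemidef) (hK : ∀ j, ∀ v ∈ K (j + 1), Cf j *ᵥ v ∈ K j)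
    (hcomp : ∀ j, S (j + 1) = S j * Cf j) (hΓ : ∀ j, (Γ j)ᴴ = Γ j)
    (hcrit : ∀ j (u : l → ℂ), IsCrit (H j) ((S j)ᴴ *ᵥ u) (K j) (Γ j *ᵥ ((S j)ᴴ *ᵥ u)))
    (hstab : ∀ j, k₀ ≤ j → (H (j + 1) - (Cf j)ᴴ * H j * Cf j).PosSemidef) {η₀ : ℝ}
    (hdat : ∀ j, k₀ ≤ j → (S k₀ * Γ k₀ * (S k₀)ᴴ - S j * Γ j * (S j)ᴴ).trace.re ≤ η₀) :
    (∀ j j', k₀ ≤ j → k₀ ≤ j' → ∀ a b, ‖(S j * Γ j * (S j)ᴴ - S j' * Γ j' * (S j')ᴴ) a b‖ ≤ η₀) ∧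
      MonotoneTailDown (fun j => (S j * Γ j * (S j)ᴴ).trace.re) k₀ :=
  ⟨norm_sub_apply_le_of_steps (P := fun j => S j * Γ j * (S j)ᴴ) (readOut_chain_step hH hK hcomp hΓ hcrit hstab) hdat,
    monotoneTailDown_re_trace (P := fun j => S j * Γ j * (S j)ᴴ) (readOut_chain_step hH hK hcomp hΓ hcrit hstab)⟩

end ReadOutComplex

/-! ## §2 (v1.1, append-only) The tower with GAUGE SLICES: criticality on the slices + slice legitimacy ⟹ the read-out chain on every T-invariant reading
(exit (iv′) of SKELETON-P4 §5: `MonotoneCoarsen.isCrit_of_slice` fed into `readOut_chain_step`) -/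

section SliceTower

open Summit.QuantumFields.BalabanUV.Beta.GAN24.MonotoneCoarsen (isCrit_of_slice)

variable {𝕜 : Type*} [Field 𝕜] [PartialOrder 𝕜] [StarRing 𝕜] [StarOrderedRing 𝕜]
variable {l : Type*} [Fintype l]
variable {ι : ℕ → Type*} [∀ j, Fintype (ι j)]
variable {H : ∀ j, Matrix (ι j) (ι j) 𝕜} {K Sl T : ∀ j, Submodule 𝕜 (ι j → 𝕜)} {Cf : ∀ j, Matrix (ι j) (ι (j + 1)) 𝕜}
  {S : ∀ j, Matrix l (ι j) 𝕜} {Γ : ∀ j, Matrix (ι j) (ι j) 𝕜} {k₀ : ℕ}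

/-- **THE READ-OUT CHAIN WITH LEVEL-DEPENDENT GAUGE SLICES.**  As `readOut_chain_step`, but the covariance columns are only known to be critical on the SLICES `K j ⊓ Sl j`
(the KKT rows of each level's own gauge fixing); in exchange each level carries gauge motions `T j` with `H j (T j) = 0`, SLICE LEGITIMACY `K j ≤ K j ⊓ Sl j ⊔ T j`, and the read
sources are `T j`-INVARIANT (`⟨t, (S j)ᴴ u⟩ = 0`; for an2's weak block-Landau slice and `T = {dλ : block sums of λ constant}`: readings with block-constant divergence, asym1-g19's
`Π_bm` currency).  Then `P j := S j Γ j (S j)ᴴ` is Loewner-antitone from `k₀` — whatever the slices. [folklore] -/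
theorem readOut_chain_step_of_slices (hH : ∀ j, (H j).PosSemidef) (hK : ∀ j, ∀ v ∈ K (j + 1), Cf j *ᵥ v ∈ K j)
    (hcomp : ∀ j, S (j + 1) = S j * Cf j) (hΓ : ∀ j, (Γ j)ᴴ = Γ j)
    (hcritS : ∀ j (u : l → 𝕜), IsCrit (H j) ((S j)ᴴ *ᵥ u) (K j ⊓ Sl j) (Γ j *ᵥ ((S j)ᴴ *ᵥ u)))
    (hleg : ∀ j, K j ≤ K j ⊓ Sl j ⊔ T j) (hHT : ∀ j, ∀ t ∈ T j, H j *ᵥ t = 0) (hST : ∀ j, ∀ t ∈ T j, ∀ u : l → 𝕜, star t ⬝ᵥ ((S j)ᴴ *ᵥ u) = 0)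
    (hstab : ∀ j, k₀ ≤ j → (H (j + 1) - (Cf j)ᴴ * H j * Cf j).PosSemidef) :
    ∀ j, k₀ ≤ j → (S j * Γ j * (S j)ᴴ - S (j + 1) * Γ (j + 1) * (S (j + 1))ᴴ).PosSemidef :=
  readOut_chain_step hH hK hcomp hΓ
    (fun j u => isCrit_of_slice (hH j).isHermitian (hcritS j u) (hleg j) (hHT j) (fun t ht => hST j t ht u)) hstab

end SliceTower

section SliceTowerComplex

open scoped ComplexOrder
open Summit.QuantumFields.BalabanUV.Beta.CapRowsTail (MonotoneTailDown)
open Summit.QuantumFields.BalabanUV.Beta.GAN24.MonotoneLoewner (norm_sub_apply_le_of_steps monotoneTailDown_re_trace)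
open Summit.QuantumFields.BalabanUV.Beta.GAN24.MonotoneCoarsen (isCrit_of_slice)

variable {l : Type*} [Fintype l]
variable {ι : ℕ → Type*} [∀ j, Fintype (ι j)]
variable {H : ∀ j, Matrix (ι j) (ι j) ℂ} {K Sl T : ∀ j, Submodule ℂ (ι j → ℂ)} {Cf : ∀ j, Matrix (ι j) (ι (j + 1)) ℂ}
  {S : ∀ j, Matrix l (ι j) ℂ} {Γ : ∀ j, Matrix (ι j) (ι j) ℂ} {k₀ : ℕ}

/-- **(MONO-K)₂ FOR THE READ-OUT BLOCK OF A SLICED TOWER, FROM (STAB), SLICE LEGITIMACY AND ONE TRACE DATUM — NO RATE** (`readOut_entry_dev_le_of_stab` at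
`readOut_chain_step_of_slices`). [folklore] -/
theorem readOut_entry_dev_le_of_slices (hH : ∀ j, (H j).PosSemidef) (hK : ∀ j, ∀ v ∈ K (j + 1), Cf j *ᵥ v ∈ K j)
    (hcomp : ∀ j, S (j + 1) = S j * Cf j) (hΓ : ∀ j, (Γ j)ᴴ = Γ j)
    (hcritS : ∀ j (u : l → ℂ), IsCrit (H j) ((S j)ᴴ *ᵥ u) (K j ⊓ Sl j) (Γ j *ᵥ ((S j)ᴴ *ᵥ u)))
    (hleg : ∀ j, K j ≤ K j ⊓ Sl j ⊔ T j) (hHT : ∀ j, ∀ t ∈ T j, H j *ᵥ t = 0) (hST : ∀ j, ∀ t ∈ T j, ∀ u : l → ℂ, star t ⬝ᵥ ((S j)ᴴ *ᵥ u) = 0)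
    (hstab : ∀ j, k₀ ≤ j → (H (j + 1) - (Cf j)ᴴ * H j * Cf j).PosSemidef) {η₀ : ℝ}
    (hdat : ∀ j, k₀ ≤ j → (S k₀ * Γ k₀ * (S k₀)ᴴ - S j * Γ j * (S j)ᴴ).trace.re ≤ η₀) :
    (∀ j j', k₀ ≤ j → k₀ ≤ j' → ∀ a b, ‖(S j * Γ j * (S j)ᴴ - S j' * Γ j' * (S j')ᴴ) a b‖ ≤ η₀) ∧
      MonotoneTailDown (fun j => (S j * Γ j * (S j)ᴴ).trace.re) k₀ :=
  readOut_entry_dev_le_of_stab hH hK hcomp hΓ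
    (fun j u => isCrit_of_slice (hH j).isHermitian (hcritS j u) (hleg j) (hHT j) (fun t ht => hST j t ht u)) hstab hdat

end SliceTowerComplex

/-! ## §3 (v1.2, append-only + one import) The tower in KKT + LEGITIMACY currency: asym1's `GaugeSliceLegitimacy` (p203730) supplies criticality on the
gauge-free space from two finite checks per level — exit (iv′) of SKELETON-P4 §5 BY NAME -/

section KKTTower

open Summit.QuantumFields.BalabanUV.Beta.GaugeSliceLegitimacy (isCrit_ker_of_kkt₂_of_disjoint_ker)

variable {𝕜 : Type*} [Field 𝕜] [PartialOrder 𝕜] [StarRing 𝕜] [StarOrderedRing 𝕜]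
variable {l : Type*} [Fintype l]
variable {ι q m : ℕ → Type*} [∀ j, Fintype (ι j)] [∀ j, Fintype (q j)] [∀ j, Fintype (m j)]
variable {H : ∀ j, Matrix (ι j) (ι j) 𝕜} {Q : ∀ j, Matrix (q j) (ι j) 𝕜} {G : ∀ j, Matrix (m j) (ι j) 𝕜} {T : ∀ j, Submodule 𝕜 (ι j → 𝕜)}
  {Cf : ∀ j, Matrix (ι j) (ι (j + 1)) 𝕜} {S : ∀ j, Matrix l (ι j) 𝕜} {Γ : ∀ j, Matrix (ι j) (ι j) 𝕜} {k₀ : ℕ}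

/-- **THE READ-OUT CHAIN FROM KKT ROWS AND SLICE LEGITIMACY.**  Per level `j`: a PSD form `H j`, constraint rows `Q j`, gauge rows `G j` (the
level's own slice), Hermitian covariance columns `Γ j` solving the two-block KKT system at every read source `r = (S j)ᴴ u` (`Q v = 0`,
`H v − r = Qᴴφ + Gᴴν`), residual gauge motions `T j ⊆ ker Q j` killed by `H j` and invisible to the readings, and asym1's two finite checks
`Disjoint (T j) (ker G j)`, `#G-rows ≤ dim T j`; across levels: `Cf j` maps `ker Q (j+1)` into `ker Q j`, readings compose `S (j+1) = S j * Cf j`,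
and (STAB_j).  Then `P j := S j Γ j (S j)ᴴ` is Loewner-antitone from `k₀` (`readOut_chain_step` ∘ `GaugeSliceLegitimacy.isCrit_ker_of_kkt₂_of_disjoint_ker`). [folklore] -/
theorem readOut_chain_step_of_kkt_legit (hH : ∀ j, (H j).PosSemidef)
    (hQC : ∀ j v, Q (j + 1) *ᵥ v = 0 → Q j *ᵥ (Cf j *ᵥ v) = 0) (hcomp : ∀ j, S (j + 1) = S j * Cf j) (hΓ : ∀ j, (Γ j)ᴴ = Γ j)
    (hkkt : ∀ j (u : l → 𝕜), Q j *ᵥ (Γ j *ᵥ ((S j)ᴴ *ᵥ u)) = 0 ∧ ∃ (φ : q j → 𝕜) (ν : m j → 𝕜),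
      H j *ᵥ (Γ j *ᵥ ((S j)ᴴ *ᵥ u)) - (S j)ᴴ *ᵥ u = (Q j)ᴴ *ᵥ φ + (G j)ᴴ *ᵥ ν)
    (hTQ : ∀ j, T j ≤ LinearMap.ker (Q j).mulVecLin) (hTH : ∀ j, ∀ t ∈ T j, H j *ᵥ t = 0)
    (hST : ∀ j, ∀ t ∈ T j, ∀ u : l → 𝕜, star t ⬝ᵥ ((S j)ᴴ *ᵥ u) = 0)
    (hdis : ∀ j, Disjoint (T j) (LinearMap.ker (G j).mulVecLin)) (hdim : ∀ j, Fintype.card (m j) ≤ Module.finrank 𝕜 (T j))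
    (hstab : ∀ j, k₀ ≤ j → (H (j + 1) - (Cf j)ᴴ * H j * Cf j).PosSemidef) :
    ∀ j, k₀ ≤ j → (S j * Γ j * (S j)ᴴ - S (j + 1) * Γ (j + 1) * (S (j + 1))ᴴ).PosSemidef := by
  refine readOut_chain_step (K := fun j => LinearMap.ker (Q j).mulVecLin) hH (fun j v hv => ?_) hcomp hΓ (fun j u => ?_) hstab
  · have hv' : Q (j + 1) *ᵥ v = 0 := by simpa [LinearMap.mem_ker, Matrix.mulVecLin_apply] using hv
    simpa [LinearMap.mem_ker, Matrix.mulVecLin_apply] using hQC j v hv'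
  · obtain ⟨hQv, φ, ν, hrow⟩ := hkkt j u
    exact isCrit_ker_of_kkt₂_of_disjoint_ker (hH j).isHermitian hQv hrow (hTQ j) (hTH j) (fun t ht => hST j t ht u) (hdis j) (hdim j)

end KKTTower

section KKTTowerComplex

open scoped ComplexOrder
open Summit.QuantumFields.BalabanUV.Beta.CapRowsTail (MonotoneTailDown)
open Summit.QuantumFields.BalabanUV.Beta.GAN24.MonotoneLoewner (norm_sub_apply_le_of_steps monotoneTailDown_re_trace)

variable {l : Type*} [Fintype l]
variable {ι q m : ℕ → Type*} [∀ j, Fintype (ι j)] [∀ j, Fintype (q j)] [∀ j, Fintype (m j)]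
variable {H : ∀ j, Matrix (ι j) (ι j) ℂ} {Q : ∀ j, Matrix (q j) (ι j) ℂ} {G : ∀ j, Matrix (m j) (ι j) ℂ} {T : ∀ j, Submodule ℂ (ι j → ℂ)}
  {Cf : ∀ j, Matrix (ι j) (ι (j + 1)) ℂ} {S : ∀ j, Matrix l (ι j) ℂ} {Γ : ∀ j, Matrix (ι j) (ι j) ℂ} {k₀ : ℕ}

/-- **(MONO-K)₂ FOR THE READ-OUT BLOCK FROM KKT ROWS, SLICE LEGITIMACY, (STAB) AND ONE TRACE DATUM — NO RATE** (over `ℂ`; gen 1's `MonotoneLoewner`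
on the chain of `readOut_chain_step_of_kkt_legit`). [folklore] -/
theorem readOut_entry_dev_le_of_kkt_legit (hH : ∀ j, (H j).PosSemidef)
    (hQC : ∀ j v, Q (j + 1) *ᵥ v = 0 → Q j *ᵥ (Cf j *ᵥ v) = 0) (hcomp : ∀ j, S (j + 1) = S j * Cf j) (hΓ : ∀ j, (Γ j)ᴴ = Γ j)
    (hkkt : ∀ j (u : l → ℂ), Q j *ᵥ (Γ j *ᵥ ((S j)ᴴ *ᵥ u)) = 0 ∧ ∃ (φ : q j → ℂ) (ν : m j → ℂ),
      H j *ᵥ (Γ j *ᵥ ((S j)ᴴ *ᵥ u)) - (S j)ᴴ *ᵥ u = (Q j)ᴴ *ᵥ φ + (G j)ᴴ *ᵥ ν)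
    (hTQ : ∀ j, T j ≤ LinearMap.ker (Q j).mulVecLin) (hTH : ∀ j, ∀ t ∈ T j, H j *ᵥ t = 0)
    (hST : ∀ j, ∀ t ∈ T j, ∀ u : l → ℂ, star t ⬝ᵥ ((S j)ᴴ *ᵥ u) = 0)
    (hdis : ∀ j, Disjoint (T j) (LinearMap.ker (G j).mulVecLin)) (hdim : ∀ j, Fintype.card (m j) ≤ Module.finrank ℂ (T j))
    (hstab : ∀ j, k₀ ≤ j → (H (j + 1) - (Cf j)ᴴ * H j * Cf j).PosSemidef) {η₀ : ℝ}
    (hdat : ∀ j, k₀ ≤ j → (S k₀ * Γ k₀ * (S k₀)ᴴ - S j * Γ j * (S j)ᴴ).trace.re ≤ η₀) :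
    (∀ j j', k₀ ≤ j → k₀ ≤ j' → ∀ a b, ‖(S j * Γ j * (S j)ᴴ - S j' * Γ j' * (S j')ᴴ) a b‖ ≤ η₀) ∧
      MonotoneTailDown (fun j => (S j * Γ j * (S j)ᴴ).trace.re) k₀ :=
  ⟨norm_sub_apply_le_of_steps (P := fun j => S j * Γ j * (S j)ᴴ)
      (readOut_chain_step_of_kkt_legit hH hQC hcomp hΓ hkkt hTQ hTH hST hdis hdim hstab) hdat,
    monotoneTailDown_re_trace (P := fun j => S j * Γ j * (S j)ᴴ)
      (readOut_chain_step_of_kkt_legit hH hQC hcomp hΓ hkkt hTQ hTH hST hdis hdim hstab)⟩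

end KKTTowerComplex

end Summit.QuantumFields.BalabanUV.Beta.GAN24.MonotoneCoarsenReadOut
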